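import Summits.KontsevichZagierPeriods.KontsevichZagierPeriods.Theorems.FermatIsogenyDeepWordSectorP03

/-! # `FermatIsogenyDeepWordSectorP04` — part 4/9 of the mechanical ≤400-line split of `DeepWordSector.lean` (sha256 5e8cd5c1c920648a…)
Source: decomp-kz lens-5 g22 DeepWordSector.lean v10 @5e8cd5c1 (the deep Beta-word sector node: bridge S ⟺ BetaWordTower ∧ WordSectorComplete, finite boxes, box ladder, shadow arithmetic, Chudnovsky levels; critic CLEARED g6-2/3/4/11/13/16/19); --supports stmt-KontsevichZagierPeriods-3898.
Split by census-1 g10 `gen/splitlean.py`: scopes re-opened with their `open`/`variable`/`set_option` context; mathematics and declaration order unchanged. -/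

namespace Summit.KontsevichZagierPeriods.FermatIsogeny.DeepTargets
open Literature.NumberTheory.Transcendental MeasureTheory
open Summit.KontsevichZagierPeriods.KontsevichZagierPeriods.Theses.FermatIsogeny (BetaLinearSector BetaProductSector FermatSectorComplete)

/-- A reduced exponent vector whose denominators divide `N > 0` is of level `N`. [bookkeeping] -/
theorem exists_lvl_eq {k N : ℕ} (hN : 0 < N) (a : Fin k → ℚ) (ha : ∀ i, 0 < a i ∧ a i ≤ 1)
    (hd : ∀ i, (a i).den ∣ N) : ∃ u : Fin k → Fin N, a = lvl N u := by
  have h : ∀ i, ∃ u : Fin N, a i = ((u : ℕ) + 1 : ℚ) / N :=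
    fun i => exists_fin_of_den_dvd (a i) (ha i).1 (ha i).2 hN (hd i)
  choose u hu using h
  exact ⟨u, funext fun i => hu i⟩

/-- **`BetaWordSectorReduced k ↔ ∀ N > 0, BetaWordSectorLevel k N`**: the reduced sector is the conjunction of its
finite boxes (common denominator of the `4k` exponents). [this node] -/
theorem betaWordSectorReduced_iff_level (k : ℕ) :
    BetaWordSectorReduced k ↔ ∀ N, 0 < N → BetaWordSectorLevel k N := by
  constructor
  · intro h N hN u v u' v' q hq
    exact h (lvl N u) (lvl N v) (lvl N u') (lvl N v') q (lvl_bounds hN u) (lvl_bounds hN v) (lvl_bounds hN u')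
      (lvl_bounds hN v') hq
  · intro h a b a' b' q ha hb ha' hb' hq r r' hr hi hr' hi' hv
    -- a common denominator
    obtain ⟨N, hNdef⟩ : ∃ N : ℕ, N = ∏ i, ((a i).den * (b i).den * ((a' i).den * (b' i).den)) := ⟨_, rfl⟩
    have hN : 0 < N := hNdef ▸ Finset.prod_pos fun i _ =>
      Nat.mul_pos (Nat.mul_pos (a i).den_pos (b i).den_pos) (Nat.mul_pos (a' i).den_pos (b' i).den_pos)
    have hdi : ∀ i, (a i).den * (b i).den * ((a' i).den * (b' i).den) ∣ N := fun i =>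
      hNdef ▸ Finset.dvd_prod_of_mem (fun i => (a i).den * (b i).den * ((a' i).den * (b' i).den)) (Finset.mem_univ i)
    have hda : ∀ i, (a i).den ∣ N := fun i =>
      (Dvd.intro _ rfl : (a i).den ∣ (a i).den * (b i).den).trans ((Dvd.intro _ rfl).trans (hdi i))
    have hdb : ∀ i, (b i).den ∣ N := fun i =>
      (Dvd.intro_left _ rfl : (b i).den ∣ (a i).den * (b i).den).trans ((Dvd.intro _ rfl).trans (hdi i))
    have hda' : ∀ i, (a' i).den ∣ N := fun i =>
      (Dvd.intro _ rfl : (a' i).den ∣ (a' i).den * (b' i).den).trans ((Dvd.intro_left _ rfl).trans (hdi i))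
    have hdb' : ∀ i, (b' i).den ∣ N := fun i =>
      (Dvd.intro_left _ rfl : (b' i).den ∣ (a' i).den * (b' i).den).trans ((Dvd.intro_left _ rfl).trans (hdi i))
    obtain ⟨u, rfl⟩ := exists_lvl_eq hN a ha hda
    obtain ⟨v, rfl⟩ := exists_lvl_eq hN b hb hdb
    obtain ⟨u', rfl⟩ := exists_lvl_eq hN a' ha' hda'
    obtain ⟨v', rfl⟩ := exists_lvl_eq hN b' hb' hdb'
    exact h N hN u v u' v' q hq r r' hr hi hr' hi' hv

/-- **`BetaWordSector k ↔ ∀ N > 0, BetaWordSectorLevel k N`** (given the two elementary Beta moves): the `k`-letter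
sector is the conjunction of its FINITE `(k, N)` boxes — the «finite/base range» of the lens, box by box; census (α)
of this node counts the deep Γ-classes each box carries. [this node] -/
theorem betaWordSector_iff_levels (hR : BetaReflectionMove) (hT : BetaTranslationMove) (k : ℕ) :
    BetaWordSector k ↔ ∀ N, 0 < N → BetaWordSectorLevel k N :=
  (betaWordSector_iff_reduced hR hT k).trans (betaWordSectorReduced_iff_level k)

/-- In particular for 3898 (`k = 2`) and 3897 (`k = 1`). [this node] -/
theorem betaProductSector_iff_levels (hR : BetaReflectionMove) (hT : BetaTranslationMove) :
    BetaProductSector ↔ ∀ N, 0 < N → BetaWordSectorLevel 2 N :=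
  betaWordSector_two_iff.symm.trans (betaWordSector_iff_levels hR hT 2)

/-- Auxiliary step `betaLinearSector_iff_levels`: beta Linear Sector iff levels. [bookkeeping] -/
theorem betaLinearSector_iff_levels (hR : BetaReflectionMove) (hT : BetaTranslationMove) :
    BetaLinearSector ↔ ∀ N, 0 < N → BetaWordSectorLevel 1 N :=
  betaWordSector_one_iff.symm.trans (betaWordSector_iff_levels hR hT 1)

/-! ## The two elementary Beta moves, PROVED (vendored verbatim from `Literature/…/KZBetaChains.lean`)

The hypotheses `BetaReflectionMove` / `BetaTranslationMove` above are the statements of the Literature theorems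
`KZ.betaReflection_equivalent` / `KZ.betaTranslation_equivalent`.  That module is fully proved but its build cone is stale on the
farm at the time of writing, so its text (supporting lemmas and both proofs, unchanged) is re-homed here under the sub-namespace
`BetaMoves` — its four imports are fresh — and the hypotheses are then DISCHARGED (`betaReflectionMove_holds`,
`betaTranslationMove_holds`), making the reduction and the finite boxes unconditional (`betaWordSector_iff_levels'`,
`betaProductSector_iff_levels'`, `betaLinearSector_iff_levels'`, `summit_iff_levels_and_wordSectorComplete`).  Once the cone is
rebuilt the block can be replaced by the two Literature names. (cite KontsevichZagier2001, §1.2) (cite AndrewsAskeyRoy1999, §1.1) -/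

namespace BetaMoves

open MeasureTheory Set
open Literature.NumberTheory.Transcendental Literature.NumberTheory.Transcendental.KZ
open Literature.ModelTheory.ExponentialFields (IsSemialgebraic isSemialgebraic_univ
  isSemialgebraic_setOf_eval_pos)
open MvPolynomial (aeval X C)

/-- `[0,1] ⊆ ℝ¹` (first-coordinate spelling) is `ℚ`-semialgebraic. [folklore] -/
private theorem isSemialgebraic_setOf_apply_mem_Icc :
    IsSemialgebraic ℚ {x : Fin 1 → ℝ | x 0 ∈ Set.Icc (0:ℝ) 1} := by
  have h1 := Literature.ModelTheory.ExponentialFields.isSemialgebraic_setOf_eval_le (k := ℚ) (R := ℝ)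
    (0 : MvPolynomial (Fin 1) ℚ) (X 0)
  have h2 := Literature.ModelTheory.ExponentialFields.isSemialgebraic_setOf_eval_le (k := ℚ) (R := ℝ)
    (X 0 : MvPolynomial (Fin 1) ℚ) 1
  have h := h1.inter h2
  simp only [map_zero, map_one, MvPolynomial.aeval_X] at h
  have hset : {x : Fin 1 → ℝ | x 0 ∈ Set.Icc (0:ℝ) 1} = {x : Fin 1 → ℝ | 0 ≤ x 0} ∩ {x | x 0 ≤ 1} := by
    ext x
    simp
  rw [hset]
  exact h

/-- `[0,1] ∖ (0,1) ⊆ ℝ¹` is null (two points). [folklore] -/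
private theorem volume_setOf_Icc_diff_Ioo :
    volume ({x : Fin 1 → ℝ | x 0 ∈ Set.Icc (0:ℝ) 1} \ {x | x 0 ∈ Set.Ioo (0:ℝ) 1}) = 0 := by
  refine measure_mono_null (fun x hx => ?_)
    (measure_union_null (BallPeeling.volume_setOf_apply_eq_const 1 (0 : Fin 1) 0)
      (BallPeeling.volume_setOf_apply_eq_const 1 (0 : Fin 1) 1))
  simp only [mem_sdiff, mem_setOf_eq, mem_Icc, mem_Ioo, not_and, not_lt] at hx
  simp only [mem_union, mem_setOf_eq]
  obtain ⟨⟨h1, h2⟩, h3⟩ := hx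
  rcases h1.lt_or_eq with h1 | h1
  · exact Or.inr (le_antisymm h2 (h3 h1))
  · exact Or.inl h1.symm

/-- Transport of integrability between `S ⊆ ℝ` and `{x | x 0 ∈ S} ⊆ ℝ¹`. [folklore] -/
private theorem integrableOn_setOf_apply_mem_iff {g : ℝ → ℝ} {S : Set ℝ} :  -- Literature home of the Summits-side `integrableOn_comp_apply_zero_iff`
    IntegrableOn (fun x : Fin 1 → ℝ => g (x 0)) {x | x 0 ∈ S} ↔ IntegrableOn g S :=
  (volume_preserving_funUnique (Fin 1) ℝ).integrableOn_comp_preimage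
    (MeasurableEquiv.funUnique (Fin 1) ℝ).measurableEmbedding

/-- **Extension by rational endpoint values**: a function on `ℝ¹` which is `ℚ`-semialgebraic on
`(0,1)` and takes rational values `c₀`, `c₁` at `x 0 = 0`, `x 0 = 1` is `ℚ`-semialgebraic on
`[0,1]` (the graph gains two rational points). [folklore] -/
private theorem isSemialgebraicFunOn_Icc_of_Ioo {f : (Fin 1 → ℝ) → ℝ}
    (hf : IsSemialgebraicFunOn ℚ {x : Fin 1 → ℝ | x 0 ∈ Set.Ioo (0:ℝ) 1} f) (c₀ c₁ : ℚ)
    (h0 : ∀ x : Fin 1 → ℝ, x 0 = 0 → f x = c₀) (h1 : ∀ x : Fin 1 → ℝ, x 0 = 1 → f x = c₁) :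
    IsSemialgebraicFunOn ℚ {x : Fin 1 → ℝ | x 0 ∈ Set.Icc (0:ℝ) 1} f := by
  rw [isSemialgebraicFunOn_iff] at hf ⊢
  have hpt : ∀ (u c : ℚ), IsSemialgebraic ℚ
      {z : Fin (1 + 1) → ℝ | (Fin.init z : Fin 1 → ℝ) 0 = (u : ℝ) ∧ z (Fin.last 1) = (c : ℝ)} := by
    intro u c
    have h1 := Literature.ModelTheory.ExponentialFields.isSemialgebraic_setOf_eval_eq_zero
      (k := ℚ) (R := ℝ) (MvPolynomial.X (Fin.castSucc (0 : Fin 1)) - MvPolynomial.C u :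
        MvPolynomial (Fin (1 + 1)) ℚ)
    have h2 := Literature.ModelTheory.ExponentialFields.isSemialgebraic_setOf_eval_eq_zero
      (k := ℚ) (R := ℝ) (MvPolynomial.X (Fin.last 1) - MvPolynomial.C c : MvPolynomial (Fin (1 + 1)) ℚ)
    convert h1.inter h2 using 1
    ext z
    simp only [mem_setOf_eq, mem_inter_iff, map_sub, MvPolynomial.aeval_X, MvPolynomial.aeval_C,
      eq_ratCast, sub_eq_zero, Fin.init]
  have hset : {z : Fin (1 + 1) → ℝ | (Fin.init z : Fin 1 → ℝ) ∈ {x : Fin 1 → ℝ | x 0 ∈ Set.Icc (0:ℝ) 1} ∧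
        z (Fin.last 1) = f (Fin.init z)} =
      {z | (Fin.init z : Fin 1 → ℝ) ∈ {x : Fin 1 → ℝ | x 0 ∈ Set.Ioo (0:ℝ) 1} ∧
        z (Fin.last 1) = f (Fin.init z)} ∪
      {z | (Fin.init z : Fin 1 → ℝ) 0 = ((0:ℚ):ℝ) ∧ z (Fin.last 1) = (c₀:ℝ)} ∪
      {z | (Fin.init z : Fin 1 → ℝ) 0 = ((1:ℚ):ℝ) ∧ z (Fin.last 1) = (c₁:ℝ)} := by
    ext z
    simp only [mem_union, mem_setOf_eq, mem_Icc, mem_Ioo, Rat.cast_zero, Rat.cast_one]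
    constructor
    · rintro ⟨⟨hl, hr⟩, hz⟩
      rcases hl.lt_or_eq with hl | hl
      · rcases hr.lt_or_eq with hr | hr
        · exact Or.inl (Or.inl ⟨⟨hl, hr⟩, hz⟩)
        · exact Or.inr ⟨hr, by rw [hz, h1 _ hr]⟩
      · exact Or.inl (Or.inr ⟨hl.symm, by rw [hz, h0 _ hl.symm]⟩)
    · rintro ((⟨⟨hl, hr⟩, hz⟩ | ⟨hl, hz⟩) | ⟨hl, hz⟩)
      · exact ⟨⟨hl.le, hr.le⟩, hz⟩
      · exact ⟨⟨hl.ge, by rw [hl]; exact zero_le_one⟩, by rw [hz, h0 _ hl]⟩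
      · exact ⟨⟨by rw [hl]; exact zero_le_one, hl.le⟩, by rw [hz, h1 _ hl]⟩
  rw [hset]
  exact (hf.union (hpt 0 c₀)).union (hpt 1 c₁)

/-- Two-factor Euler–Mellin monomials `c · (x 0)^e · (1 − x 0)^{e'}` (`c, e, e' ∈ ℚ`) are
`ℚ`-semialgebraic on `(0,1) ⊆ ℝ¹` (`KZ.isSemialgebraicFunOn_mellinIntegrand`). [folklore] -/
private theorem isSemialgebraicFunOn_const_mul_rpow_mul_rpow (c e e' : ℚ) :
    IsSemialgebraicFunOn ℚ {x : Fin 1 → ℝ | x 0 ∈ Set.Ioo (0:ℝ) 1}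
      (fun x => (c : ℝ) * ((x 0) ^ ((e : ℚ) : ℝ) * (1 - x 0) ^ ((e' : ℚ) : ℝ))) := by
  refine (isSemialgebraicFunOn_mellinIntegrand BallPeeling.isSemialgebraic_posIoo
    ![MvPolynomial.X 0, 1 - MvPolynomial.X 0] ![e, e'] c (fun x hx k => ?_)).congr fun x _ => ?_
  · have hx' : 0 < x 0 ∧ x 0 < 1 := hx
    fin_cases k
    · simpa using hx'.1
    · simp only [Fin.mk_one, Matrix.cons_val_one, Matrix.cons_val_fin_one, map_sub, map_one,
        MvPolynomial.aeval_X, sub_pos]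
      exact hx'.2
  · simp [mellinIntegrand_apply, Fin.prod_univ_two]

/-- The derivative of `t^a (1-t)^b` inside `(0,1)`. [folklore] -/
private theorem hasDerivAt_rpow_mul_one_sub_rpow {a b t : ℝ} (ht : t ∈ Set.Ioo (0:ℝ) 1) :
    HasDerivAt (fun s : ℝ => s ^ a * (1 - s) ^ b)
      (a * t ^ (a - 1) * (1 - t) ^ b + t ^ a * (-1 * b * (1 - t) ^ (b - 1))) t := by
  have h1 : HasDerivAt (fun s : ℝ => s ^ a) (a * t ^ (a - 1)) t :=
    Real.hasDerivAt_rpow_const (Or.inl ht.1.ne')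
  have h2 : HasDerivAt (fun s : ℝ => (1 - s) ^ b) (-1 * b * (1 - t) ^ (b - 1)) t := by
    have h := ((hasDerivAt_id t).const_sub 1).rpow_const (p := b)
      (Or.inl (by simp only [id]; linarith [ht.2]))
    simpa using h
  exact h1.mul h2

/-! ## Symmetry: `t ↦ 1 − t` -/

/-- **`[(0,1), t^{a-1}(1-t)^{b-1}] ∼ [(0,1), t^{b-1}(1-t)^{a-1}]`** for representations pinned
by their integrands on `(0,1)`: ONE change of variables `t ↦ 1 − t` (`|det| = 1`).
(cite KontsevichZagier2001, §1.2 rule (2)) -/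
private theorem betaReflection_equivalent (α β : ℝ) (ρ ρ' : IntegralRep 1)
    (hρd : ρ.domain = {x | x 0 ∈ Set.Ioo (0:ℝ) 1})
    (hρi : Set.EqOn ρ.integrand (fun x => (x 0) ^ α * (1 - x 0) ^ β) ρ.domain)
    (hρ'd : ρ'.domain = {x | x 0 ∈ Set.Ioo (0:ℝ) 1})
    (hρ'i : Set.EqOn ρ'.integrand (fun x => (x 0) ^ β * (1 - x 0) ^ α) ρ'.domain) :
    Equivalent ρ ρ' := by
  refine of_sub_of_mem_relations_of_boxReflection (0 : Fin 1) ?_ fun x hx => ?_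
  · rw [hρd, hρ'd]
    ext x
    simp only [mem_setOf_eq, mem_preimage, boxReflection_apply_self, mem_Ioo]
    constructor <;> rintro ⟨h1, h2⟩ <;> constructor <;> linarith
  · have hx' : x 0 ∈ Set.Ioo (0:ℝ) 1 := by rw [hρd] at hx; exact hx
    have hx'' : boxReflection (0 : Fin 1) x ∈ ρ'.domain := by
      rw [hρ'd]
      show boxReflection 0 x 0 ∈ Set.Ioo (0:ℝ) 1
      rw [boxReflection_apply_self]
      exact ⟨by linarith [hx'.2], by linarith [hx'.1]⟩
    rw [hρi hx, hρ'i hx'']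
    simp only [boxReflection_apply_self, sub_sub_cancel]
    ring

/-! ## The translation `(a+b)·β(a,b+1) ∼ b·β(a,b)` (integration by parts inside the rules) -/

/-- **`[(0,1), (a+b) t^{a-1}(1-t)^{b}] ∼ [(0,1), b t^{a-1}(1-t)^{b-1}]`** for `0 < a, b ∈ ℚ` and
representations pinned by their integrands on `(0,1)`: ONE Newton–Leibniz move from the point
`ℝ⁰` (band `[0,1]`, primitive `F(t) = t^a (1-t)^b`, `F(0) = F(1) = 0`, so
`[[0,1], F'] − [pt, 0]` is a move and `[[0,1], F'] ∈ relations`), the null boundary `{0,1}`, and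
ONE integrand-additivity move on `(0,1)`:
`(a+b) t^{a-1}(1-t)^b = F'(t) + b t^{a-1}(1-t)^{b-1}` with `F' = a t^{a-1}(1-t)^b − b t^a(1-t)^{b-1}`.
Value identity: `(a+b) B(a,b+1) = b B(a,b)`. (cite AndrewsAskeyRoy1999, §1.1) -/
private theorem betaTranslation_equivalent (a b : ℚ) (ha : 0 < a) (hb : 0 < b) (ρ ρ' : IntegralRep 1)
    (hρd : ρ.domain = {x | x 0 ∈ Set.Ioo (0:ℝ) 1})
    (hρi : Set.EqOn ρ.integrand (fun x => ((a:ℝ) + b) * ((x 0) ^ ((a:ℝ) - 1) * (1 - x 0) ^ (b:ℝ)))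
      ρ.domain)
    (hρ'd : ρ'.domain = {x | x 0 ∈ Set.Ioo (0:ℝ) 1})
    (hρ'i : Set.EqOn ρ'.integrand (fun x => (b:ℝ) * ((x 0) ^ ((a:ℝ) - 1) * (1 - x 0) ^ ((b:ℝ) - 1)))
      ρ'.domain) :
    Equivalent ρ ρ' := by
  have ha' : (a:ℝ) ≠ 0 := by exact_mod_cast ha.ne'
  have hb' : (b:ℝ) ≠ 0 := by exact_mod_cast hb.ne'
  have haR : (0:ℝ) < a := by exact_mod_cast ha
  have hbR : (0:ℝ) < b := by exact_mod_cast hb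
  -- the derivative of the primitive, extended by `0` to the closed interval
  set g : ℝ → ℝ := fun t => if t ∈ Set.Ioo (0:ℝ) 1 then
      (a:ℝ) * t ^ ((a:ℝ) - 1) * (1 - t) ^ (b:ℝ) + t ^ (a:ℝ) * (-1 * (b:ℝ) * (1 - t) ^ ((b:ℝ) - 1))
    else 0 with hgdef
  have hI1 : IntegrableOn (fun t : ℝ => t ^ ((a:ℝ) - 1) * (1 - t) ^ (b:ℝ)) (Set.Ioo 0 1) := by
    have h := (Literature.Analysis.SpecialFunctions.Selberg.integrableOn_Ioo_rpow_mul_one_sub_rpow_and_integral_eq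
      haR (by linarith : (0:ℝ) < b + 1)).1
    simpa only [add_sub_cancel_right] using h
  have hI2 : IntegrableOn (fun t : ℝ => t ^ (a:ℝ) * (1 - t) ^ ((b:ℝ) - 1)) (Set.Ioo 0 1) := by
    have h := (Literature.Analysis.SpecialFunctions.Selberg.integrableOn_Ioo_rpow_mul_one_sub_rpow_and_integral_eq
      (by linarith : (0:ℝ) < a + 1) hbR).1
    simpa only [add_sub_cancel_right] using h
  have hgi : IntegrableOn g (Set.Icc (0:ℝ) 1) := by
    rw [integrableOn_Icc_iff_integrableOn_Ioo]
    refine IntegrableOn.congr_fun ((hI1.const_mul (a:ℝ)).add (hI2.const_mul (-(b:ℝ))))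
      (fun t ht => ?_) measurableSet_Ioo
    simp only [hgdef, if_pos ht, Pi.add_apply]
    ring
  have hg_sa : IsSemialgebraicFunOn ℚ {x : Fin 1 → ℝ | x 0 ∈ Set.Icc (0:ℝ) 1}
      (fun x : Fin 1 → ℝ => g (x 0)) := by
    refine isSemialgebraicFunOn_Icc_of_Ioo ?_ 0 0 (fun x hx => ?_) (fun x hx => ?_)
    · refine (IsSemialgebraicFunOn.add_holds
        (isSemialgebraicFunOn_const_mul_rpow_mul_rpow a (a - 1) b)
        (isSemialgebraicFunOn_const_mul_rpow_mul_rpow (-b) a (b - 1))).congr fun x hx => ?_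
      have hx' : x 0 ∈ Set.Ioo (0:ℝ) 1 := hx
      simp only [hgdef, if_pos hx', Pi.add_apply, Rat.cast_sub, Rat.cast_one, Rat.cast_neg]
      ring
    · have : x 0 ∉ Set.Ioo (0:ℝ) 1 := fun h => by rw [hx] at h; exact lt_irrefl _ h.1
      simp only [hgdef, if_neg this, Rat.cast_zero]
    · have : x 0 ∉ Set.Ioo (0:ℝ) 1 := fun h => by rw [hx] at h; exact lt_irrefl _ h.2
      simp only [hgdef, if_neg this, Rat.cast_zero]
  -- the band representation `D = [[0,1], g]` and the base `Z = [pt, 0]`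
  obtain ⟨D, hDd, hDi⟩ : ∃ D : IntegralRep 1, D.domain = {x : Fin 1 → ℝ | x 0 ∈ Set.Icc (0:ℝ) 1} ∧
      D.integrand = fun x => g (x 0) :=
    ⟨⟨_, _, isSemialgebraic_setOf_apply_mem_Icc, hg_sa, integrableOn_setOf_apply_mem_iff.2 hgi⟩,
      rfl, rfl⟩
  obtain ⟨Z, hZd, hZi⟩ : ∃ Z : IntegralRep 0, Z.domain = univ ∧ Z.integrand = 0 :=
    exists_zeroRep isSemialgebraic_univ
  have hF_sa : IsSemialgebraicFunOn ℚ {x : Fin 1 → ℝ | x 0 ∈ Set.Icc (0:ℝ) 1}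
      (fun z : Fin 1 → ℝ => (z 0) ^ (a:ℝ) * (1 - z 0) ^ (b:ℝ)) := by
    refine isSemialgebraicFunOn_Icc_of_Ioo ?_ 0 0 (fun x hx => ?_) (fun x hx => ?_)
    · exact (isSemialgebraicFunOn_const_mul_rpow_mul_rpow 1 a b).congr fun x _ => by
        simp only [Rat.cast_one, one_mul]
    · simp only [hx, Real.zero_rpow ha', zero_mul, Rat.cast_zero]
    · simp only [hx, sub_self, Real.zero_rpow hb', mul_zero, Rat.cast_zero]
  have hNL : of D - of Z ∈ newtonLeibnizRel := by
    refine ⟨0, D, Z, fun _ => ((0:ℕ):ℝ), fun _ => ((0:ℕ):ℝ) + 1,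
      fun z => (z (Fin.last 0)) ^ (a:ℝ) * (1 - z (Fin.last 0)) ^ (b:ℝ), by rw [hDd]; exact hF_sa,
      by rw [hZd]; exact isSemialgebraicFunOn_natCast isSemialgebraic_univ 0, ?_,
      fun _ _ => by simp, ?_, ?_, ?_, ?_, rfl⟩
    · rw [hZd]
      exact (isSemialgebraicFunOn_aeval isSemialgebraic_univ
        (((0:ℕ) : MvPolynomial (Fin 0) ℚ) + 1)).congr fun x _ => by simp
    · rw [hDd, hZd]
      ext z
      simp only [mem_univ, true_and, mem_setOf_eq, mem_Icc, Nat.cast_zero, zero_add]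
      rfl
    · intro x _
      simp only [Fin.snoc_last, Nat.cast_zero, zero_add]
      exact ((continuousOn_id.rpow_const fun t _ => Or.inr (by positivity)).mul
        ((continuousOn_const.sub continuousOn_id).rpow_const fun t _ => Or.inr (by positivity)))
    · intro x _ t ht
      simp only [Nat.cast_zero, zero_add] at ht
      simp only [Fin.snoc_last, hDi]
      rw [show (0 : Fin 1) = Fin.last 0 from rfl, Fin.snoc_last]
      have hgt : g t = (a:ℝ) * t ^ ((a:ℝ) - 1) * (1 - t) ^ (b:ℝ) +
          t ^ (a:ℝ) * (-1 * (b:ℝ) * (1 - t) ^ ((b:ℝ) - 1)) := by simp only [hgdef, if_pos ht]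
      rw [hgt]
      exact hasDerivAt_rpow_mul_one_sub_rpow ht
    · intro x _
      simp only [hZi, Pi.zero_apply, Fin.snoc_last, Nat.cast_zero, zero_add, Real.one_rpow,
        sub_self, Real.zero_rpow hb', Real.zero_rpow ha', mul_zero, zero_mul, sub_zero]
  have hZ_mem : of Z ∈ relations := of_mem_relations_of_eqOn_zero Z (by rw [hZi]; exact fun _ _ => rfl)
  have hD_mem : of D ∈ relations := by
    have := relations.add_mem (newtonLeibnizRel_subset_relations hNL) hZ_mem
    rwa [sub_add_cancel] at this
  -- its open restriction
  have hsub : {x : Fin 1 → ℝ | x 0 ∈ Set.Ioo (0:ℝ) 1} ⊆ D.domain := by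
    rw [hDd]
    exact fun x hx => ⟨hx.1.le, hx.2.le⟩
  set D₀ := D.restrict _ BallPeeling.isSemialgebraic_posIoo hsub with hD₀
  have hD₀_mem : of D₀ ∈ relations := by
    have h1 := D.of_sub_of_restrict_mem_relations BallPeeling.isSemialgebraic_posIoo hsub
      (by rw [hDd]; exact volume_setOf_Icc_diff_Ioo)
    have := relations.sub_mem hD_mem h1
    rwa [sub_sub_cancel] at this
  -- integrand additivity on (0,1): ρ = D₀ + ρ'
  have hadd : of ρ - of D₀ - of ρ' ∈ integrandAddRel := by
    refine ⟨1, ρ, D₀, ρ', by rw [hρd]; rfl, by rw [hρ'd, hρd], fun x hx => ?_, rfl⟩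
    have hx' : x 0 ∈ Set.Ioo (0:ℝ) 1 := by rw [hρd] at hx; exact hx
    have hxρ' : x ∈ ρ'.domain := by rw [hρ'd]; exact hx'
    rw [Pi.add_apply, hρi hx, hρ'i hxρ']
    simp only [hD₀, IntegralRep.integrand_restrict, hDi, hgdef, if_pos hx']
    have ht0 : (x 0) ≠ 0 := hx'.1.ne'
    have h1t : (1 - x 0) ≠ 0 := (sub_pos.2 hx'.2).ne'
    have e1 : (x 0) ^ (a:ℝ) = (x 0) ^ ((a:ℝ) - 1) * x 0 := by
      rw [Real.rpow_sub_one ht0, div_mul_cancel₀ _ ht0]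
    have e2 : (1 - x 0) ^ (b:ℝ) = (1 - x 0) ^ ((b:ℝ) - 1) * (1 - x 0) := by
      rw [Real.rpow_sub_one h1t, div_mul_cancel₀ _ h1t]
    rw [e1, e2]
    ring
  have := relations.add_mem (integrandAddRel_subset_relations hadd) hD₀_mem
  have h' : of ρ - of D₀ - of ρ' + of D₀ = of ρ - of ρ' := by abel
  rw [h'] at this
  exact this

end BetaMoves

/-! ## Unconditional forms -/

/-- The reflection move holds (vendored Literature proof `BetaMoves.betaReflection_equivalent`). -/
theorem betaReflectionMove_holds : BetaReflectionMove :=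
  fun α β ρ ρ' hρd hρi hρ'd hρ'i => BetaMoves.betaReflection_equivalent α β ρ ρ' hρd hρi hρ'd hρ'i

/-- The translation move holds (vendored Literature proof `BetaMoves.betaTranslation_equivalent`). -/
theorem betaTranslationMove_holds : BetaTranslationMove :=
  fun a b ha hb ρ ρ' hρd hρi hρ'd hρ'i => BetaMoves.betaTranslation_equivalent a b ha hb ρ ρ' hρd hρi hρ'd hρ'i

end Summit.KontsevichZagierPeriods.FermatIsogeny.DeepTargets
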